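import Literature.Barriers.Parity.SiegelZeroQuadraticPolynomialsProgressions
import Literature.Barriers.Parity.SiegelZeroQuadraticPolynomialsErrorSums
import HarnessLib

/-!
# Granville–Mollin's Theorem 4: the error sum of (6.1)–(6.2) over the large and the huge prime
# divisors `q'` (ranges `q' > N/16`, `y ≤ q' ≤ q^{9.5}`, `q^{9.5} < q' ≤ N/2^{M+1}`)

Topic `Literature/Barriers/Parity`, summation layer of the proof of
`Literature.Barriers.Parity.GranvilleMollin2000_thm4` (Granville–Mollin, *Rabinowitsch revisited*,
Acta Arith. 96 (2000), Theorem 4, §6B, (6.2): "If `y ≤ q ≤ N/y` then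
`∏_{p ≤ N/q}(1 − ω(p)/p) ∼ ϱ_d` and `∑_{y<q<N/y} ω(q)/q = o(1)` by (5.7) … We note that, for
`N/y ≤ q ≤ N`, we have `∏_{N/q<p≤y}(1 − ω(p)/p)⁻¹ ≪ min{1/ϱ_d, (log y/log(N/q))²}`. Now
`∑_{x<p<2x} ω(p)/p ≪ 1/log(d^η)` for `x > d^C`, by (5.5)."). Everything is PROVED; no definition
is introduced. For `d = −q`, `q ≡ 3 (mod 8)`, and the progression counts
`T(q', r) = #{n ∈ apIndex N q' r : (f_d(n), P(y)) = 1}` summed over the roots `r` of `f_d`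
mod `q'` (`SiegelZeroQuadraticPolynomialsProgressions.lean`), this file bounds
`∑_{q'} ∑_r T(q', r)` over three ranges of primes `q'`:

* `sum_rangeP0_le` — `N/16 < q' ≤ 2N` (progressions with fewer than `17` terms): `≤ 17 · 4K_c (N/16)(2⁵ − 1)`
  from the (5.5)-type block bounds `∑_{x<p≤2x} ω(p) ≤ 4 K_c x` (`K_c = K/(η log q)`).
* `sum_rangeI_le` — `y ≤ q' ≤ q^{9.5}` (sieve up to `z = y`; Heath-Brown's Lemma 3 in the form
  `∑_{p ≤ q^500} ω(p) log p/p ≤ H` controls `∑ ω(q')/q'`): `≤ (1 + Cω) N V(y) (H/log y + H/log √q) +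
  e⁸ log² y · 17 √N √(q^{9.5})`.
* `sum_rangeIIa_le` — `q^{9.5} < q' ≤ u` with `y² u ≤ N`, `2u ≤ N` (sieve up to `z = y`; (5.5)-type
  blocks): `≤ (1 + Cω) N V(y) · 4K_c log N/log 2 + e⁸ log² y · 12 K_c N`.

The range `N/y⁴ < q' ≤ N/16` (the weights `min{1/ϱ_d, (log y/log(N/q))²}`) is
`SiegelZeroQuadraticPolynomialsRangesB.lean`.

[cite: GranvilleMollin2000, §6B (6.2)]
-/

noncomputable section

open Finset Real Polynomial
open Literature.NumberTheory.Sieve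

namespace Literature.Barriers.Parity

/-! ### Range P0: `N/16 < q' ≤ 2N` -/

/-- **Short progressions**: for `q ≡ 3 (mod 8)`, the (5.5)-type input with constant `K_c` on
`[q^{9.5}, X₁)`, `q^{9.5} ≥ 2`, `q^{9.5} ≤ N/16` and `2N < X₁`:
`∑_{N/16 < q' ≤ 2N} ∑_r T(q', r) ≤ 17 · 4K_c (N/16) (2⁵ − 1)` (each progression has `≤ N/q' + 1 < 17`
terms, and `∑_{N/16 < q' ≤ 2N} ω(q')` is five dyadic blocks). [cite: GranvilleMollin2000, §6B (6.2)] -/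
theorem sum_rangeP0_le {d : ℤ} {q N : ℕ} {Kc X₁ : ℝ} (hKc : 0 ≤ Kc)
    (h55 : ∀ t : ℝ, (q : ℝ) ^ ((19 : ℝ) / 2) ≤ t → t < X₁ →
      ∑ p ∈ Nat.primesLE ⌊t⌋₊, (polyRootCountMod ![rabinowitschPoly d] p : ℝ) * Real.log p ≤
        Kc * (t * Real.log t))
    (hq95 : 2 ≤ (q : ℝ) ^ ((19 : ℝ) / 2)) (hN16 : (q : ℝ) ^ ((19 : ℝ) / 2) ≤ (N : ℝ) / 16)
    (hX₁ : 2 * (N : ℝ) < X₁) (y : ℝ) :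
    ∑ q' ∈ (Nat.primesLE ⌊(2 : ℝ) ^ 5 * ((N : ℝ) / 16)⌋₊).filter (fun q' => ⌊(N : ℝ) / 16⌋₊ < q'),
      ∑ r ∈ (range q').filter (fun r : ℕ => (q' : ℤ) ∣ (rabinowitschPoly d).eval (r : ℤ)),
        (#((apIndex N q' r).filter fun n : ℕ =>
          ((rabinowitschPoly d).eval (n : ℤ)).natAbs.Coprime (primesProdBelow y)) : ℝ) ≤
      17 * (4 * Kc * ((N : ℝ) / 16) * ((2 : ℝ) ^ 5 - 1)) := by
  have hx0 : 0 ≤ (N : ℝ) / 16 := by positivity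
  -- each progression is short
  have hT : ∀ q' ∈ (Nat.primesLE ⌊(2 : ℝ) ^ 5 * ((N : ℝ) / 16)⌋₊).filter (fun q' => ⌊(N : ℝ) / 16⌋₊ < q'),
      ∑ r ∈ (range q').filter (fun r : ℕ => (q' : ℤ) ∣ (rabinowitschPoly d).eval (r : ℤ)),
        (#((apIndex N q' r).filter fun n : ℕ =>
          ((rabinowitschPoly d).eval (n : ℤ)).natAbs.Coprime (primesProdBelow y)) : ℝ) ≤
        (polyRootCountMod ![rabinowitschPoly d] q' : ℝ) * 17 := by
    intro q' hq'
    rw [mem_filter] at hq'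
    have hprime := Nat.prime_of_mem_primesLE hq'.1
    have hq'0 : (0 : ℝ) < q' := by exact_mod_cast hprime.pos
    have hgt : (N : ℝ) / 16 < q' := (Nat.floor_lt hx0).mp hq'.2
    have hX : (N : ℝ) / q' < 16 := by
      rw [div_lt_iff₀ hq'0]; rw [div_lt_iff₀ (by norm_num)] at hgt; linarith
    refine sum_roots_le_mul _ fun r _ => ?_
    exact (card_apIndex_filter_le hprime.pos r _).trans (by linarith)
  -- the five dyadic blocks
  have hblock : ∀ j < 5, ∑ p ∈ (Nat.primesLE ⌊(2 : ℝ) ^ (j + 1) * ((N : ℝ) / 16)⌋₊).filter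
      (fun p => ⌊(2 : ℝ) ^ j * ((N : ℝ) / 16)⌋₊ < p), (polyRootCountMod ![rabinowitschPoly d] p : ℝ) ≤
        4 * Kc * ((2 : ℝ) ^ j * ((N : ℝ) / 16)) := by
    intro j hj
    have h2j : (1 : ℝ) ≤ (2 : ℝ) ^ j := one_le_pow₀ (by norm_num)
    have hxj : (q : ℝ) ^ ((19 : ℝ) / 2) ≤ (2 : ℝ) ^ j * ((N : ℝ) / 16) :=
      hN16.trans (le_mul_of_one_le_left hx0 h2j)
    have hj4 : (2 : ℝ) ^ (j + 1) ≤ (2 : ℝ) ^ 5 := pow_le_pow_right₀ (by norm_num) hj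
    have hX : 2 * ((2 : ℝ) ^ j * ((N : ℝ) / 16)) < X₁ := by
      calc 2 * ((2 : ℝ) ^ j * ((N : ℝ) / 16)) = (2 : ℝ) ^ (j + 1) * ((N : ℝ) / 16) := by ring
        _ ≤ (2 : ℝ) ^ 5 * ((N : ℝ) / 16) := mul_le_mul_of_nonneg_right hj4 hx0
        _ = 2 * N := by norm_num; ring
        _ < X₁ := hX₁
    have h := sum_omega_block_le_of_chebyshev (d := d) hKc h55 (hq95.trans hxj) hxj hX
    rwa [show 2 * ((2 : ℝ) ^ j * ((N : ℝ) / 16)) = (2 : ℝ) ^ (j + 1) * ((N : ℝ) / 16) by ring] at h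
  have hsum := sum_omega_dyadic_le (d := d) hx0 5 hblock
  calc ∑ q' ∈ (Nat.primesLE ⌊(2 : ℝ) ^ 5 * ((N : ℝ) / 16)⌋₊).filter (fun q' => ⌊(N : ℝ) / 16⌋₊ < q'),
        ∑ r ∈ (range q').filter (fun r : ℕ => (q' : ℤ) ∣ (rabinowitschPoly d).eval (r : ℤ)),
          (#((apIndex N q' r).filter fun n : ℕ =>
            ((rabinowitschPoly d).eval (n : ℤ)).natAbs.Coprime (primesProdBelow y)) : ℝ)
      ≤ ∑ q' ∈ (Nat.primesLE ⌊(2 : ℝ) ^ 5 * ((N : ℝ) / 16)⌋₊).filter (fun q' => ⌊(N : ℝ) / 16⌋₊ < q'),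
          (polyRootCountMod ![rabinowitschPoly d] q' : ℝ) * 17 := sum_le_sum hT
    _ = 17 * ∑ q' ∈ (Nat.primesLE ⌊(2 : ℝ) ^ 5 * ((N : ℝ) / 16)⌋₊).filter
          (fun q' => ⌊(N : ℝ) / 16⌋₊ < q'), (polyRootCountMod ![rabinowitschPoly d] q' : ℝ) := by
        rw [mul_sum]; refine sum_congr rfl fun _ _ => ?_; ring
    _ ≤ 17 * (4 * Kc * ((N : ℝ) / 16) * ((2 : ℝ) ^ 5 - 1)) :=
        mul_le_mul_of_nonneg_left hsum (by norm_num)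

/-! ### Sieving a progression up to `z = y` -/

/-- The per-progression bound with `z = y`: for a prime `q' ≥ y ≥ 2` with `y² q' ≤ N`,
`∑_r T(q', r) ≤ ω(q') [(1 + Cω)(N/q') V(y) + √(N/q') e⁸ log² y]`. [cite: GranvilleMollin2000, §6B (6.2)] -/
theorem sum_roots_card_le_of_sq_mul_le {d : ℤ} {q N q' : ℕ} (hdq : d = -(q : ℤ)) (hq8 : q % 8 = 3)
    (hqN : q ≤ N) (hN : 2 ≤ N) {y : ℝ} (hy : 2 ≤ y) (hq' : q'.Prime) (hyq' : y ≤ q')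
    (hy2 : y ^ 2 * q' ≤ N) :
    ∑ r ∈ (range q').filter (fun r : ℕ => (q' : ℤ) ∣ (rabinowitschPoly d).eval (r : ℤ)),
        (#((apIndex N q' r).filter fun n : ℕ =>
          ((rabinowitschPoly d).eval (n : ℤ)).natAbs.Coprime (primesProdBelow y)) : ℝ) ≤
      (polyRootCountMod ![rabinowitschPoly d] q' : ℝ) *
        ((1 + SieveSequence.flConst 2 (2 * Real.exp (17 + 12 / Real.log 2))) * ((N : ℝ) / q') *
            ∏ p ∈ Nat.primesBelow ⌈y⌉₊, (1 - (polyRootCountMod ![rabinowitschPoly d] p : ℝ) / p) +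
          Real.sqrt ((N : ℝ) / q') * (Real.exp 8 * Real.log y ^ 2)) := by
  have hq'0 : (0 : ℝ) < q' := by exact_mod_cast hq'.pos
  have hzX : y ≤ Real.sqrt ((N : ℝ) / q') := by
    have h1 : y ^ 2 ≤ (N : ℝ) / q' := by rw [le_div_iff₀ hq'0]; exact hy2
    calc y = Real.sqrt (y ^ 2) := (Real.sqrt_sq (by linarith)).symm
      _ ≤ Real.sqrt ((N : ℝ) / q') := Real.sqrt_le_sqrt h1
  exact sum_roots_le_mul _ fun r _ =>
    rabinowitsch_card_apIndex_coprime_le hdq hq8 hq' hqN hN hy le_rfl hyq' hzX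

/-- Splitting `∑_{q'} ω(q') [(1 + Cω)(N/q') V + √(N/q') R]` into `(1 + Cω) N V ∑ ω(q')/q' + R ∑ ω(q') √(N/q')`.
[folklore] -/
theorem sum_omega_mul_split {d : ℤ} (S : Finset ℕ) (N V R C : ℝ) :
    ∑ q' ∈ S, (polyRootCountMod ![rabinowitschPoly d] q' : ℝ) *
        (C * (N / q') * V + Real.sqrt (N / q') * R) =
      C * N * V * ∑ q' ∈ S, (polyRootCountMod ![rabinowitschPoly d] q' : ℝ) / q' +
        R * ∑ q' ∈ S, (polyRootCountMod ![rabinowitschPoly d] q' : ℝ) * Real.sqrt (N / q') := by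
  rw [mul_sum, mul_sum, ← sum_add_distrib]
  refine sum_congr rfl fun q' _ => ?_
  ring

/-! ### Range I: `y ≤ q' ≤ q^{9.5}` -/

/-- **Range I** (`y ≤ q' ≤ q^{9.5}`, sieving each progression up to `z = y`): for
`q ≡ 3 (mod 8)`, `q ≤ N`, `2 ≤ y ≤ √q`, `y⁴ q^{9.5} ≤ N`, and the Heath-Brown input
`∑_{p ≤ q^500} ω(p) log p/p ≤ H`:
`∑_{y ≤ q' ≤ q^{9.5}} ∑_r T(q', r) ≤ (1 + Cω) N V(y) (H/log y + H/log √q) + e⁸ log² y · 17 √N √(q^{9.5})`.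
[cite: GranvilleMollin2000, §6B (6.2) with §5C (5.6)] -/
theorem sum_rangeI_le {d : ℤ} {q N : ℕ} (hdq : d = -(q : ℤ)) (hq8 : q % 8 = 3) (hqN : q ≤ N)
    (hN : 2 ≤ N) {y H : ℝ} (hy : 2 ≤ y) (hysq : y ≤ Real.sqrt q)
    (hy4 : y ^ 4 * (q : ℝ) ^ ((19 : ℝ) / 2) ≤ N)
    (hH : ∑ p ∈ Nat.primesLE ⌊(q : ℝ) ^ (500 : ℝ)⌋₊,
        (polyRootCountMod ![rabinowitschPoly d] p : ℝ) * Real.log p / p ≤ H) :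
    ∑ q' ∈ (Nat.primesLE ⌊(q : ℝ) ^ ((19 : ℝ) / 2)⌋₊).filter (fun q' => ⌈y⌉₊ - 1 < q'),
      ∑ r ∈ (range q').filter (fun r : ℕ => (q' : ℤ) ∣ (rabinowitschPoly d).eval (r : ℤ)),
        (#((apIndex N q' r).filter fun n : ℕ =>
          ((rabinowitschPoly d).eval (n : ℤ)).natAbs.Coprime (primesProdBelow y)) : ℝ) ≤
      (1 + SieveSequence.flConst 2 (2 * Real.exp (17 + 12 / Real.log 2))) * N *
          (∏ p ∈ Nat.primesBelow ⌈y⌉₊, (1 - (polyRootCountMod ![rabinowitschPoly d] p : ℝ) / p)) *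
          (H / Real.log y + H / Real.log (Real.sqrt q)) +
        Real.exp 8 * Real.log y ^ 2 * (17 * Real.sqrt N * Real.sqrt ((q : ℝ) ^ ((19 : ℝ) / 2))) := by
  have hq4 : q % 4 = 3 := by omega
  have hy1 : 1 < y := by linarith
  have hy0 : 0 < y := by linarith
  have hq0 : (0 : ℝ) < q := by
    have h := lt_of_lt_of_le hy0 hysq
    by_contra hcon
    have : Real.sqrt q = 0 := Real.sqrt_eq_zero'.mpr (not_lt.mp hcon)
    rw [this] at h; exact lt_irrefl _ h
  have hq1 : (1 : ℝ) ≤ q := by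
    by_contra hcon
    have h1 : Real.sqrt q < 1 := by
      rw [show (1 : ℝ) = Real.sqrt 1 by simp]
      exact Real.sqrt_lt_sqrt hq0.le (not_le.mp hcon)
    linarith
  set Q95 : ℝ := (q : ℝ) ^ ((19 : ℝ) / 2) with hQ95
  have hQ95_0 : 0 < Q95 := Real.rpow_pos_of_pos hq0 _
  have hsqrt_le : Real.sqrt q ≤ Q95 := by
    rw [Real.sqrt_eq_rpow]; exact Real.rpow_le_rpow_of_exponent_le hq1 (by norm_num)
  have hQ95_500 : Q95 ≤ (q : ℝ) ^ (500 : ℝ) := Real.rpow_le_rpow_of_exponent_le hq1 (by norm_num)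
  -- the window and its elements
  set a₀ : ℕ := ⌈y⌉₊ - 1 with ha₀
  have hceil1 : 1 ≤ ⌈y⌉₊ := Nat.one_le_iff_ne_zero.mpr (Nat.ceil_pos.mpr hy0).ne'
  have ha₀R : ((a₀ : ℕ) : ℝ) + 1 = ⌈y⌉₊ := by
    rw [ha₀]; push_cast [Nat.cast_sub hceil1]; ring
  have ha₀y : y ≤ ((a₀ : ℕ) : ℝ) + 1 := by rw [ha₀R]; exact Nat.le_ceil y
  have ha₀_ge : 1 ≤ a₀ := by
    have : (2 : ℝ) ≤ ⌈y⌉₊ := hy.trans (Nat.le_ceil y)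
    have h2 : 2 ≤ ⌈y⌉₊ := by exact_mod_cast this
    omega
  -- per-progression bound on the range
  have hper : ∀ q' ∈ (Nat.primesLE ⌊Q95⌋₊).filter (fun q' => a₀ < q'),
      ∑ r ∈ (range q').filter (fun r : ℕ => (q' : ℤ) ∣ (rabinowitschPoly d).eval (r : ℤ)),
        (#((apIndex N q' r).filter fun n : ℕ =>
          ((rabinowitschPoly d).eval (n : ℤ)).natAbs.Coprime (primesProdBelow y)) : ℝ) ≤
        (polyRootCountMod ![rabinowitschPoly d] q' : ℝ) *
          ((1 + SieveSequence.flConst 2 (2 * Real.exp (17 + 12 / Real.log 2))) * ((N : ℝ) / q') *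
              ∏ p ∈ Nat.primesBelow ⌈y⌉₊, (1 - (polyRootCountMod ![rabinowitschPoly d] p : ℝ) / p) +
            Real.sqrt ((N : ℝ) / q') * (Real.exp 8 * Real.log y ^ 2)) := by
    intro q' hq'
    rw [mem_filter, Nat.mem_primesLE] at hq'
    have hprime := hq'.1.2
    have hyq' : y ≤ q' := by
      have : ((a₀ : ℕ) : ℝ) + 1 ≤ q' := by exact_mod_cast hq'.2
      exact ha₀y.trans this
    have hq'le : (q' : ℝ) ≤ Q95 := le_trans (by exact_mod_cast hq'.1.1) (Nat.floor_le hQ95_0.le)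
    have hy2 : y ^ 2 * q' ≤ N := by
      have hy14 : y ^ 2 ≤ y ^ 4 := pow_le_pow_right₀ (by linarith) (by norm_num)
      calc y ^ 2 * q' ≤ y ^ 4 * Q95 := mul_le_mul hy14 hq'le (Nat.cast_nonneg _) (by positivity)
        _ ≤ N := hy4
    exact sum_roots_card_le_of_sq_mul_le hdq hq8 hqN hN hy hprime hyq' hy2
  refine (sum_le_sum hper).trans ?_
  rw [sum_omega_mul_split]
  -- (i) `∑ ω(q')/q'` by Heath-Brown, split at `√q`
  have hs1 : a₀ ≤ ⌊Real.sqrt q⌋₊ := ceil_sub_one_le_floor_sqrt hysq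
  have hs2 : ⌊Real.sqrt q⌋₊ ≤ ⌊Q95⌋₊ := Nat.floor_le_floor hsqrt_le
  have hdiv : ∑ q' ∈ (Nat.primesLE ⌊Q95⌋₊).filter (fun q' => a₀ < q'),
      (polyRootCountMod ![rabinowitschPoly d] q' : ℝ) / q' ≤ H / Real.log y + H / Real.log (Real.sqrt q) := by
    rw [sum_primesLE_filter_lt_split hs1 hs2]
    refine add_le_add ?_ ?_
    · exact sum_omega_div_window_le_of_weighted hy1 ha₀y
        ((Nat.floor_le_floor hsqrt_le).trans (Nat.floor_le_floor hQ95_500)) hH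
    · have hw : 1 < Real.sqrt q := lt_of_lt_of_le hy1 hysq
      exact sum_omega_div_window_le_of_weighted hw (Nat.lt_floor_add_one _).le
        (Nat.floor_le_floor hQ95_500) hH
  -- (ii) `∑ ω(q') √(N/q')` by the trivial dyadic bound from `x₁ = a₀`
  set x₁ : ℝ := ((a₀ : ℕ) : ℝ) with hx₁
  have hx₁1 : 1 ≤ x₁ := by rw [hx₁]; exact_mod_cast ha₀_ge
  have hx₁0 : 0 < x₁ := by linarith
  have hx₁Q : x₁ ≤ Q95 := by
    have hc : ((⌈y⌉₊ : ℕ) : ℝ) < y + 1 := Nat.ceil_lt_add_one hy0.le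
    have : x₁ ≤ y := by linarith [ha₀R]
    exact this.trans (hysq.trans hsqrt_le)
  obtain ⟨J₁, hJ₁ge, hJ₁lt⟩ := exists_pow_two_mul_ge_lt hx₁0 hx₁Q
  have hfloor_x₁ : ⌊x₁⌋₊ = a₀ := by rw [hx₁, Nat.floor_natCast]
  have hsub : (Nat.primesLE ⌊Q95⌋₊).filter (fun q' => a₀ < q') ⊆
      (Nat.primesLE ⌊(2 : ℝ) ^ J₁ * x₁⌋₊).filter (fun q' => ⌊x₁⌋₊ < q') := by
    intro p hp
    rw [mem_filter, Nat.mem_primesLE] at hp ⊢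
    rw [hfloor_x₁]
    exact ⟨⟨hp.1.1.trans (Nat.floor_le_floor hJ₁ge), hp.1.2⟩, hp.2⟩
  have hblock : ∀ j < J₁, ∑ p ∈ (Nat.primesLE ⌊(2 : ℝ) ^ (j + 1) * x₁⌋₊).filter
      (fun p => ⌊(2 : ℝ) ^ j * x₁⌋₊ < p), (polyRootCountMod ![rabinowitschPoly d] p : ℝ) ≤
        4 * ((2 : ℝ) ^ j * x₁) := by
    intro j _
    have h1 : 1 ≤ (2 : ℝ) ^ j * x₁ := one_le_mul_of_one_le_of_one_le (one_le_pow₀ (by norm_num)) hx₁1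
    have h := sum_omega_block_le_trivial hdq hq4 h1
    rwa [show 2 * ((2 : ℝ) ^ j * x₁) = (2 : ℝ) ^ (j + 1) * x₁ by ring] at h
  have hsqrt := sum_omega_sqrt_dyadic_le (d := d) hx₁0 (by norm_num : (0 : ℝ) ≤ 4)
    (Nat.cast_nonneg N) J₁ hblock
  have hrem : ∑ q' ∈ (Nat.primesLE ⌊Q95⌋₊).filter (fun q' => a₀ < q'),
      (polyRootCountMod ![rabinowitschPoly d] q' : ℝ) * Real.sqrt ((N : ℝ) / q') ≤
        17 * Real.sqrt N * Real.sqrt Q95 := by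
    refine (sum_le_sum_of_subset_of_nonneg hsub fun _ _ _ => by positivity).trans (hsqrt.trans ?_)
    have h2 : Real.sqrt ((2 : ℝ) ^ J₁ * x₁) ≤ Real.sqrt 2 * Real.sqrt Q95 := by
      rw [← Real.sqrt_mul (by norm_num)]
      exact Real.sqrt_le_sqrt hJ₁lt.le
    have hs2 : Real.sqrt 2 ≤ 17 / 12 := by
      calc Real.sqrt 2 ≤ Real.sqrt ((17 / 12) ^ 2) := Real.sqrt_le_sqrt (by norm_num)
        _ = 17 / 12 := Real.sqrt_sq (by norm_num)
    calc 3 * 4 * Real.sqrt N * Real.sqrt ((2 : ℝ) ^ J₁ * x₁) ≤ 3 * 4 * Real.sqrt N * (Real.sqrt 2 * Real.sqrt Q95) :=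
          mul_le_mul_of_nonneg_left h2 (by positivity)
      _ ≤ 3 * 4 * Real.sqrt N * (17 / 12 * Real.sqrt Q95) := by
          refine mul_le_mul_of_nonneg_left (mul_le_mul_of_nonneg_right hs2 (Real.sqrt_nonneg _)) ?_
          positivity
      _ = 17 * Real.sqrt N * Real.sqrt Q95 := by ring
  -- assemble
  have hV0 : 0 ≤ ∏ p ∈ Nat.primesBelow ⌈y⌉₊, (1 - (polyRootCountMod ![rabinowitschPoly d] p : ℝ) / p) :=
    (prod_one_sub_rootCount_pos (rabinowitsch_omega_hyps hdq hq8).1 (rabinowitsch_omega_hyps hdq hq8).2 y).le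
  have hC0 : 0 ≤ 1 + SieveSequence.flConst 2 (2 * Real.exp (17 + 12 / Real.log 2)) := by
    have := SieveSequence.flConst_pos (κ := 2) (K := 2 * Real.exp (17 + 12 / Real.log 2))
      (by norm_num) (by positivity)
    linarith
  exact add_le_add (mul_le_mul_of_nonneg_left hdiv (by positivity))
    (mul_le_mul_of_nonneg_left hrem (by positivity))

/-! ### Range IIa: `q^{9.5} < q' ≤ u`, `y² u ≤ N`, `2u ≤ N` -/

/-- **Range IIa** (`q^{9.5} < q' ≤ u`, sieving up to `z = y`; here `u = N/2^{M+1} < N/y⁴`): for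
`q ≡ 3 (mod 8)`, `q ≤ N`, `y ≥ 2`, the (5.5)-type input with constant `K_c` on `[q^{9.5}, X₁)`,
`2 ≤ q^{9.5} ≤ u`, `2u ≤ N < X₁` and `y² u ≤ N`:
`∑_{q^{9.5} < q' ≤ u} ∑_r T(q', r) ≤ (1 + Cω) N V(y) · 4K_c log N/log 2 + e⁸ log² y · 12 K_c N`.
[cite: GranvilleMollin2000, §6B (6.2)] -/
theorem sum_rangeIIa_le {d : ℤ} {q N : ℕ} (hdq : d = -(q : ℤ)) (hq8 : q % 8 = 3) (hqN : q ≤ N)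
    (hN : 2 ≤ N) {y Kc X₁ u : ℝ} (hy : 2 ≤ y) (hKc : 0 ≤ Kc)
    (h55 : ∀ t : ℝ, (q : ℝ) ^ ((19 : ℝ) / 2) ≤ t → t < X₁ →
      ∑ p ∈ Nat.primesLE ⌊t⌋₊, (polyRootCountMod ![rabinowitschPoly d] p : ℝ) * Real.log p ≤
        Kc * (t * Real.log t))
    (hq95 : 2 ≤ (q : ℝ) ^ ((19 : ℝ) / 2)) (hyq : y ≤ (q : ℝ) ^ ((19 : ℝ) / 2))
    (hu : (q : ℝ) ^ ((19 : ℝ) / 2) ≤ u) (huN : 2 * u ≤ N)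
    (hX₁ : (N : ℝ) < X₁) (hyu : y ^ 2 * u ≤ N) :
    ∑ q' ∈ (Nat.primesLE ⌊u⌋₊).filter (fun q' => ⌊(q : ℝ) ^ ((19 : ℝ) / 2)⌋₊ < q'),
      ∑ r ∈ (range q').filter (fun r : ℕ => (q' : ℤ) ∣ (rabinowitschPoly d).eval (r : ℤ)),
        (#((apIndex N q' r).filter fun n : ℕ =>
          ((rabinowitschPoly d).eval (n : ℤ)).natAbs.Coprime (primesProdBelow y)) : ℝ) ≤
      (1 + SieveSequence.flConst 2 (2 * Real.exp (17 + 12 / Real.log 2))) * N *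
          (∏ p ∈ Nat.primesBelow ⌈y⌉₊, (1 - (polyRootCountMod ![rabinowitschPoly d] p : ℝ) / p)) *
          (4 * Kc * (Real.log N / Real.log 2)) +
        Real.exp 8 * Real.log y ^ 2 * (12 * Kc * N) := by
  set Q95 : ℝ := (q : ℝ) ^ ((19 : ℝ) / 2) with hQ95
  have hQ0 : 0 < Q95 := by linarith
  have hu0 : 0 < u := lt_of_lt_of_le hQ0 hu
  have hN0 : (0 : ℝ) < N := by linarith
  -- per-progression bound on the range
  have hper : ∀ q' ∈ (Nat.primesLE ⌊u⌋₊).filter (fun q' => ⌊Q95⌋₊ < q'),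
      ∑ r ∈ (range q').filter (fun r : ℕ => (q' : ℤ) ∣ (rabinowitschPoly d).eval (r : ℤ)),
        (#((apIndex N q' r).filter fun n : ℕ =>
          ((rabinowitschPoly d).eval (n : ℤ)).natAbs.Coprime (primesProdBelow y)) : ℝ) ≤
        (polyRootCountMod ![rabinowitschPoly d] q' : ℝ) *
          ((1 + SieveSequence.flConst 2 (2 * Real.exp (17 + 12 / Real.log 2))) * ((N : ℝ) / q') *
              ∏ p ∈ Nat.primesBelow ⌈y⌉₊, (1 - (polyRootCountMod ![rabinowitschPoly d] p : ℝ) / p) +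
            Real.sqrt ((N : ℝ) / q') * (Real.exp 8 * Real.log y ^ 2)) := by
    intro q' hq'
    rw [mem_filter, Nat.mem_primesLE] at hq'
    have hprime := hq'.1.2
    have hgt : Q95 < q' := (Nat.floor_lt hQ0.le).mp hq'.2
    have hyq' : y ≤ q' := hyq.trans hgt.le
    have hq'u : (q' : ℝ) ≤ u := le_trans (by exact_mod_cast hq'.1.1) (Nat.floor_le hu0.le)
    have hy2 : y ^ 2 * q' ≤ N :=
      le_trans (mul_le_mul_of_nonneg_left hq'u (by positivity)) hyu
    exact sum_roots_card_le_of_sq_mul_le hdq hq8 hqN hN hy hprime hyq' hy2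
  refine (sum_le_sum hper).trans ?_
  rw [sum_omega_mul_split]
  -- dyadic cover of `(Q95, u]` from `x = Q95`
  obtain ⟨J₂, hJ₂ge, hJ₂lt⟩ := exists_pow_two_mul_ge_lt hQ0 hu
  have hJ₂N : (2 : ℝ) ^ J₂ * Q95 ≤ N := by linarith
  have hsub : (Nat.primesLE ⌊u⌋₊).filter (fun q' => ⌊Q95⌋₊ < q') ⊆
      (Nat.primesLE ⌊(2 : ℝ) ^ J₂ * Q95⌋₊).filter (fun q' => ⌊Q95⌋₊ < q') := by
    intro p hp
    rw [mem_filter, Nat.mem_primesLE] at hp ⊢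
    exact ⟨⟨hp.1.1.trans (Nat.floor_le_floor hJ₂ge), hp.1.2⟩, hp.2⟩
  -- block bounds
  have hxj : ∀ j < J₂, Q95 ≤ (2 : ℝ) ^ j * Q95 ∧ 2 ≤ (2 : ℝ) ^ j * Q95 ∧ 2 * ((2 : ℝ) ^ j * Q95) < X₁ := by
    intro j hj
    have h2j : (1 : ℝ) ≤ (2 : ℝ) ^ j := one_le_pow₀ (by norm_num)
    have h1 : Q95 ≤ (2 : ℝ) ^ j * Q95 := le_mul_of_one_le_left hQ0.le h2j
    refine ⟨h1, hq95.trans h1, ?_⟩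
    have hj1 : (2 : ℝ) ^ (j + 1) ≤ (2 : ℝ) ^ J₂ := pow_le_pow_right₀ (by norm_num) hj
    calc 2 * ((2 : ℝ) ^ j * Q95) = (2 : ℝ) ^ (j + 1) * Q95 := by ring
      _ ≤ (2 : ℝ) ^ J₂ * Q95 := mul_le_mul_of_nonneg_right hj1 hQ0.le
      _ ≤ N := hJ₂N
      _ < X₁ := hX₁
  have hblock_div : ∀ j < J₂, ∑ p ∈ (Nat.primesLE ⌊(2 : ℝ) ^ (j + 1) * Q95⌋₊).filter
      (fun p => ⌊(2 : ℝ) ^ j * Q95⌋₊ < p), (polyRootCountMod ![rabinowitschPoly d] p : ℝ) / p ≤ 4 * Kc := by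
    intro j hj
    obtain ⟨h1, h2, h3⟩ := hxj j hj
    have h := sum_omega_div_block_le_of_chebyshev (d := d) hKc h55 h2 h1 h3
    rwa [show 2 * ((2 : ℝ) ^ j * Q95) = (2 : ℝ) ^ (j + 1) * Q95 by ring] at h
  have hblock : ∀ j < J₂, ∑ p ∈ (Nat.primesLE ⌊(2 : ℝ) ^ (j + 1) * Q95⌋₊).filter
      (fun p => ⌊(2 : ℝ) ^ j * Q95⌋₊ < p), (polyRootCountMod ![rabinowitschPoly d] p : ℝ) ≤
        4 * Kc * ((2 : ℝ) ^ j * Q95) := by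
    intro j hj
    obtain ⟨h1, h2, h3⟩ := hxj j hj
    have h := sum_omega_block_le_of_chebyshev (d := d) hKc h55 h2 h1 h3
    rwa [show 2 * ((2 : ℝ) ^ j * Q95) = (2 : ℝ) ^ (j + 1) * Q95 by ring] at h
  -- (i) `∑ ω/q' ≤ J₂ · 4Kc ≤ 4Kc log N / log 2`
  have hJ₂ : (J₂ : ℝ) ≤ Real.log N / Real.log 2 := by
    have h2J : (2 : ℝ) ^ J₂ ≤ N := by
      have : (2 : ℝ) ^ J₂ * 1 ≤ (2 : ℝ) ^ J₂ * Q95 :=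
        mul_le_mul_of_nonneg_left (by linarith) (by positivity)
      linarith
    have hlog := Real.log_le_log (by positivity) h2J
    rw [Real.log_pow] at hlog
    rw [le_div_iff₀ (Real.log_pos one_lt_two)]
    exact hlog
  have hdiv : ∑ q' ∈ (Nat.primesLE ⌊u⌋₊).filter (fun q' => ⌊Q95⌋₊ < q'),
      (polyRootCountMod ![rabinowitschPoly d] q' : ℝ) / q' ≤ 4 * Kc * (Real.log N / Real.log 2) := by
    refine (sum_le_sum_of_subset_of_nonneg hsub fun _ _ _ => by positivity).trans ?_
    refine (sum_omega_div_dyadic_le (d := d) hQ0.le J₂ hblock_div).trans ?_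
    rw [mul_comm]
    exact mul_le_mul_of_nonneg_left hJ₂ (by positivity)
  -- (ii) `∑ ω √(N/q') ≤ 12 Kc N`
  have hrem : ∑ q' ∈ (Nat.primesLE ⌊u⌋₊).filter (fun q' => ⌊Q95⌋₊ < q'),
      (polyRootCountMod ![rabinowitschPoly d] q' : ℝ) * Real.sqrt ((N : ℝ) / q') ≤ 12 * Kc * N := by
    refine (sum_le_sum_of_subset_of_nonneg hsub fun _ _ _ => by positivity).trans ?_
    refine (sum_omega_sqrt_dyadic_le (d := d) hQ0 (by positivity) (Nat.cast_nonneg N) J₂ hblock).trans ?_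
    have h1 : Real.sqrt ((2 : ℝ) ^ J₂ * Q95) ≤ Real.sqrt N := Real.sqrt_le_sqrt hJ₂N
    have h2 : Real.sqrt (N : ℝ) * Real.sqrt N = N := Real.mul_self_sqrt hN0.le
    calc 3 * (4 * Kc) * Real.sqrt N * Real.sqrt ((2 : ℝ) ^ J₂ * Q95) ≤ 3 * (4 * Kc) * Real.sqrt N * Real.sqrt N :=
          mul_le_mul_of_nonneg_left h1 (by positivity)
      _ = 12 * Kc * N := by rw [mul_assoc, h2]; ring
  -- assemble
  have hV0 : 0 ≤ ∏ p ∈ Nat.primesBelow ⌈y⌉₊, (1 - (polyRootCountMod ![rabinowitschPoly d] p : ℝ) / p) :=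
    (prod_one_sub_rootCount_pos (rabinowitsch_omega_hyps hdq hq8).1 (rabinowitsch_omega_hyps hdq hq8).2 y).le
  have hC0 : 0 ≤ 1 + SieveSequence.flConst 2 (2 * Real.exp (17 + 12 / Real.log 2)) := by
    have := SieveSequence.flConst_pos (κ := 2) (K := 2 * Real.exp (17 + 12 / Real.log 2))
      (by norm_num) (by positivity)
    linarith
  exact add_le_add (mul_le_mul_of_nonneg_left hdiv (by positivity))
    (mul_le_mul_of_nonneg_left hrem (by positivity))

end Literature.Barriers.Parity
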